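import Literature.AnabelianGeometry.EtaleTheta.Discharge.Sec5Prop53
import Literature.AlgebraicGeometry.Frobenioids.PerfectionPrimes
import Mathlib.Algebra.Module.Rat

/-!
# [EtTh] Proposition 5.3 (ii), (iii) at PERFECT divisor monoids: component isomorphisms between copies of `ℚ_{≥0}`
# are positive scalings, so compatibility with `Ψ^Φ_{A_⊚}` is decided on ONE element per component (the prime log-divisor)

Mochizuki, *The étale theta function and its Frobenioid-theoretic manifestations*, Publ. RIMS **45** (2009),
Prop. 5.3 (ii), (iii) p.325 (PDF p.99): "`Ψ^Φ_{A_⊚}` preserves … the natural isomorphisms between distinct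
[non-]cuspidal primary components of `Φ(A_⊚)`", the isomorphisms being "determined by identifying the elements on
each side that arise from [scheme-theoretic] prime log-divisors"; Prop. 5.1 p.323 (PDF p.97) ("`Φ(−)` is perfect");
Prop. 3.2 (i) p.296 (PDF p.70) (`DIV_+(Z^log_∞)^pf` "a direct product of copies of `ℚ_{≥0}`")
[cite: MochizukiEtTh2009, Prop 5.3 p.325 (PDF p.99)] [cite: MochizukiEtTh2009, Prop 5.1 p.323 (PDF p.97)]
[cite: MochizukiFrdI2008, §0 p.11–12].

abc-iut cell, block F, seat abc-iut-f-127 (OWNER of tranche 127: F-0559 `PreservesCspComponentIsos`, …).  PROOF-ONLY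
companion (0 defs) of abc-iut-L2-d4's `Discharge/Sec5Prop53.lean` and of this seat's vacuity certificate
`Discharge/Sec5Prop53PerfectVacuity.lean` (p434934/p436191: at data meeting Prop. 5.1's "`Φ(−)` perfect" the
hypothesis "`Φ(A_⊚)_𝔭 ≃ ℤ_{≥0}`" of the instance forms of record of Prop. 5.3 (ii)/(iii) is unsatisfiable, since
every `Φ(A_⊚)_𝔭` is then a PERFECT monoid).  This file supplies the POSITIVE replacement of L2-d4's rigidity lemma
`mulEquiv_eq_of_equiv_nat` ("between two copies of `ℤ_{≥0}` there is exactly one isomorphism") for the printed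
shape `Φ(A_⊚)_𝔭 ≅ ℚ_{≥0}`:

* `addMonoidHom_nnrat_apply` — an additive endomorphism of `ℚ_{≥0}` is `q ↦ q · g(1)` (`map_nnrat_smul`);
* `MulEquivNNRat.apply_eq` — an automorphism `f` of `Multiplicative ℚ_{≥0}` is the scaling
  `x ↦ x^{c}`, `c = f(1) ∈ ℚ_{>0}`;
* **`mulEquiv_eq_of_equiv_nnrat_of_apply_eq`** — two isomorphisms between monoids that are copies of `ℚ_{≥0}`
  COINCIDE as soon as they agree at ONE non-trivial element (there is a `ℚ_{>0}`-torsor of them, not one);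
* **`FrobenioidThetaDivisors.apply_componentIso_eq_of_apply_eq`** — hence, for any automorphism `ψ` of `Φ(A_⊚)`
  whose prime components are copies of `ℚ_{≥0}` (`hQ`), and any component isomorphisms `j : Φ_𝔭 ⥲ Φ_𝔮`,
  `j' : Φ_{ψ𝔭} ⥲ Φ_{ψ𝔮}`, the compatibility `ψ ∘ j = j' ∘ ψ` on ALL of `Φ_𝔭` follows from the single equation at
  one non-trivial `x₀ ∈ Φ_𝔭` — in print: at the prime log-divisor;
* **`preservesNcspComponentIsos_of_generators` / `preservesCspComponentIsos_of_generators`** — the honest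
  instance-form SHAPE of Prop. 5.3 (ii)/(iii) at perfect data: given (i) on primes, the typed clauses follow from
  the compatibility of `Ψ^Φ_{A_⊚}` with the component isomorphisms at ONE non-trivial element per pair of primes
  (the genuinely geometric content — [EtTh] Rmk. 3.8.2 / p.325 — which nobody asserts here).
Relation to abc-iut-f-128's `Discharge/Sec5Prop53Coordinates.lean` (p436610, `preserves{N,C}spComponentIsos_of_coordinates`:
(ii)/(iii) from coordinate-preservation of the component isomorphisms and of `Ψ^Φ_{A_⊚}`): complementary and
coordinate-FREE — here no coordinate system is fixed; the only input beyond `hQ` is one equation per pair of primes.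
`hQ` is satisfiable at the printed shape (e.g. `Φ := ⊕_{ℤ⊔ℤ} ℚ_{≥0}`, abc-iut-f-009's `Sec5Prop53Toy`), unlike the
`ℤ_{≥0}` hypothesis; copies of `ℚ_{≥0}` are perfect (`Frobenioids.isPerfect_of_mulEquiv_nnrat`).
HONEST FRAMING: monoid algebra and implications between OUR typed predicates; Prop. 5.3 is neither proved nor
refuted; no side is taken on [IUTchIII] Cor. 3.12; typed ≠ proved.
-/

namespace Literature.AnabelianGeometry.EtaleTheta

open CategoryTheory
open Literature.AlgebraicGeometry.Frobenioids

universe w v v' u u'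

/-! ### Lines `ℚ_{≥0}`: endomorphisms are scalings -/

section NNRatLines

/-- An additive endomorphism of `ℚ_{≥0}` is multiplication by its value at `1` (`ℚ_{≥0}`-linearity of additive
maps between `ℚ_{≥0}`-modules, `map_nnrat_smul`) — the lines `ℚ_{≥0}` of [EtTh] Prop. 3.2 (i).
[cite: MochizukiEtTh2009, Prop 3.2 (i) p.296 (PDF p.70)] -/
theorem addMonoidHom_nnrat_apply (g : ℚ≥0 →+ ℚ≥0) (q : ℚ≥0) : g q = q * g 1 := by
  have h := map_nnrat_smul g q (1 : ℚ≥0)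
  rwa [smul_eq_mul, smul_eq_mul, mul_one] at h

/-- A multiplicative isomorphism `f` of `Multiplicative ℚ_{≥0}` is the scaling by `c := f(1)`:
`f(x) = c · x` additively (automorphisms of a line `ℚ_{≥0}` of [EtTh] Prop. 3.2 (i)).
[cite: MochizukiEtTh2009, Prop 3.2 (i) p.296 (PDF p.70)] -/
theorem MulEquivNNRat.apply_eq (f : Multiplicative ℚ≥0 ≃* Multiplicative ℚ≥0) (x : Multiplicative ℚ≥0) :
    Multiplicative.toAdd (f x) =
      Multiplicative.toAdd x * Multiplicative.toAdd (f (Multiplicative.ofAdd 1)) := by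
  let g : ℚ≥0 →+ ℚ≥0 :=
    { toFun := fun q => Multiplicative.toAdd (f (Multiplicative.ofAdd q))
      map_zero' := by simp
      map_add' := fun a b => by simp [ofAdd_add, map_mul, toAdd_mul] }
  have h := addMonoidHom_nnrat_apply g (Multiplicative.toAdd x)
  simpa [g] using h

/-- The scaling factor of an isomorphism of `Multiplicative ℚ_{≥0}` is non-zero.
[cite: MochizukiEtTh2009, Prop 3.2 (i) p.296 (PDF p.70)] -/
theorem MulEquivNNRat.apply_one_ne_zero (f : Multiplicative ℚ≥0 ≃* Multiplicative ℚ≥0) :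
    Multiplicative.toAdd (f (Multiplicative.ofAdd 1)) ≠ 0 := by
  intro h0
  have h1 : f (Multiplicative.ofAdd 1) = 1 := by
    apply Multiplicative.toAdd.injective
    rw [h0]
    rfl
  have h2 : Multiplicative.ofAdd (1 : ℚ≥0) = 1 := by
    rw [← map_one f] at h1
    exact f.injective h1
  exact one_ne_zero (Multiplicative.ofAdd.injective h2 : (1 : ℚ≥0) = 0)

/-- **Rigidity of the line `ℚ_{≥0}` (replacing `mulEquiv_multiplicative_nat_eq_refl`): two automorphisms of
`Multiplicative ℚ_{≥0}` that agree at one non-trivial element are equal** (a line `ℚ_{≥0}` of [EtTh] Prop. 3.2 (i)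
has the `ℚ_{>0}`-torsor of automorphisms). [cite: MochizukiEtTh2009, Prop 3.2 (i) p.296 (PDF p.70)] -/
theorem MulEquivNNRat.eq_of_apply_eq (f g : Multiplicative ℚ≥0 ≃* Multiplicative ℚ≥0)
    {x₀ : Multiplicative ℚ≥0} (hx₀ : x₀ ≠ 1) (h : f x₀ = g x₀) : f = g := by
  have hx₀' : Multiplicative.toAdd x₀ ≠ 0 := fun h0 =>
    hx₀ (Multiplicative.toAdd.injective (by rw [h0]; rfl))
  have hc : Multiplicative.toAdd (f (Multiplicative.ofAdd 1)) = Multiplicative.toAdd (g (Multiplicative.ofAdd 1)) := by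
    have hf := MulEquivNNRat.apply_eq f x₀
    have hg := MulEquivNNRat.apply_eq g x₀
    rw [h] at hf
    exact mul_left_cancel₀ hx₀' (hf.symm.trans hg)
  apply MulEquiv.ext
  intro x
  apply Multiplicative.toAdd.injective
  rw [MulEquivNNRat.apply_eq f x, MulEquivNNRat.apply_eq g x, hc]

/-- **Between two monoids that are copies of `ℚ_{≥0}` an isomorphism is determined by the image of ONE
non-trivial element** (there is a `ℚ_{>0}`-torsor of isomorphisms — contrast `mulEquiv_eq_of_equiv_nat` for copies of
`ℤ_{≥0}`, where the isomorphism is unique).  In print (p.325) the pinning element is the prime log-divisor.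
[cite: MochizukiEtTh2009, Prop 5.3 p.325 (PDF p.99)] -/
theorem mulEquiv_eq_of_equiv_nnrat_of_apply_eq {A B : Type*} [Monoid A] [Monoid B]
    (iA : A ≃* Multiplicative ℚ≥0) (iB : B ≃* Multiplicative ℚ≥0) (e₁ e₂ : A ≃* B)
    {a : A} (ha : a ≠ 1) (h : e₁ a = e₂ a) : e₁ = e₂ := by
  have key : iA.symm.trans (e₁.trans iB) = iA.symm.trans (e₂.trans iB) := by
    refine MulEquivNNRat.eq_of_apply_eq _ _ (x₀ := iA a) ?_ ?_
    · intro h1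
      exact ha (by simpa using congrArg iA.symm h1)
    · simp [h]
  apply MulEquiv.ext
  intro x
  have := MulEquiv.congr_fun key (iA x)
  simpa using this

end NNRatLines

/-! ### Proposition 5.3 (ii), (iii) at perfect data: compatibility decided on one element per pair of primes -/

namespace FrobenioidThetaDivisors

variable {C : Type u} [Category.{v} C] {D : Type u'} [Category.{v'} D] {𝔉 : ThetaFrobenioid.{w} C D}
  (𝔓 : DivisorPrimeData 𝔉) (Ψ : C ≌ C) (ι : Ψ.functor.obj 𝔉.Acirc ≅ 𝔉.Acirc)
  (e : 𝔉.PhiAcirc ≃* 𝔉.pre.Mon (𝔉.base.obj (Ψ.functor.obj 𝔉.Acirc)))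

/-- **The perfect-data replacement of `apply_componentIso_eq`.**  For a monoid automorphism `ψ` of `Φ(A_⊚)` whose
prime components are copies of `ℚ_{≥0}` (`hQ` — the printed shape, Prop. 3.2 (i); satisfiable, unlike `ℤ_{≥0}`),
and isomorphisms `j : Φ_𝔭 ⥲ Φ_𝔮`, `j' : Φ_{ψ𝔭} ⥲ Φ_{ψ𝔮}`: if `ψ ∘ j` and `j' ∘ ψ` agree at ONE non-trivial
`x₀ ∈ Φ_𝔭`, they agree on all of `Φ_𝔭`.  [cite: MochizukiEtTh2009, Prop 5.3 p.325 (PDF p.99)] -/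
theorem apply_componentIso_eq_of_apply_eq (ψ : 𝔉.PhiAcirc ≃* 𝔉.PhiAcirc)
    (hQ : ∀ 𝔭 : Primes 𝔉.PhiAcirc, Nonempty (𝔭.submonoid ≃* Multiplicative ℚ≥0))
    (p q : Primes 𝔉.PhiAcirc) (j : p.submonoid ≃* q.submonoid)
    (j' : (Primes.congr ψ p).submonoid ≃* (Primes.congr ψ q).submonoid)
    (x₀ : p.submonoid) (hx₀ : x₀ ≠ 1)
    (h₀ : ψ (j x₀ : 𝔉.PhiAcirc) = (j' (Primes.submonoidCongr ψ p _ rfl x₀) : 𝔉.PhiAcirc))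
    (x : p.submonoid) :
    ψ (j x : 𝔉.PhiAcirc) = (j' (Primes.submonoidCongr ψ p _ rfl x) : 𝔉.PhiAcirc) := by
  obtain ⟨iP⟩ := hQ p
  obtain ⟨iQ'⟩ := hQ (Primes.congr ψ q)
  have heq : j.trans (Primes.submonoidCongr ψ q _ rfl) = (Primes.submonoidCongr ψ p _ rfl).trans j' :=
    mulEquiv_eq_of_equiv_nnrat_of_apply_eq iP iQ' _ _ hx₀ (Subtype.ext h₀)
  exact congrArg (fun E : p.submonoid ≃* (Primes.congr ψ q).submonoid => ((E x : _) : 𝔉.PhiAcirc)) heq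

/-- **[EtTh] Proposition 5.3 (ii) at perfect data, honest instance-form shape**: given (i) on primes and prime
components that are copies of `ℚ_{≥0}`, `Ψ^Φ_{A_⊚}` is compatible with the isomorphisms between non-cuspidal primary
components as soon as it is so at ONE non-trivial element of each `Φ(A_⊚)_𝔭` (print: at the prime log-divisors,
"identifying the elements on each side that arise from prime log-divisors" — the geometric input, NOT asserted here).
[cite: MochizukiEtTh2009, Prop 5.3 (ii) p.325 (PDF p.99)] -/
theorem preservesNcspComponentIsos_of_generators (hc : CuspPreserved 𝔓 Ψ ι e)
    (hQ : ∀ 𝔭 : Primes 𝔉.PhiAcirc, Nonempty (𝔭.submonoid ≃* Multiplicative ℚ≥0))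
    (hgen : ∀ (p q : Primes 𝔉.PhiAcirc) (hp : ¬ 𝔓.IsCuspidal p) (hq : ¬ 𝔓.IsCuspidal q), p ≠ q →
      ∃ x₀ : p.submonoid, x₀ ≠ 1 ∧
        psiPhi 𝔉 Ψ ι e (𝔓.ncspIso p q hp hq x₀ : 𝔉.PhiAcirc) =
          (𝔓.ncspIso _ _ (fun h => hp ((hc p).mp h)) (fun h => hq ((hc q).mp h))
            (Primes.submonoidCongr (psiPhi 𝔉 Ψ ι e) p _ rfl x₀) : 𝔉.PhiAcirc)) :
    PreservesNcspComponentIsos 𝔓 Ψ ι e hc := by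
  intro p q hp hq hpq x
  obtain ⟨x₀, hx₀, h₀⟩ := hgen p q hp hq hpq
  exact apply_componentIso_eq_of_apply_eq (psiPhi 𝔉 Ψ ι e) hQ p q (𝔓.ncspIso p q hp hq) _ x₀ hx₀ h₀ x

/-- **[EtTh] Proposition 5.3 (iii) at perfect data, honest instance-form shape** (cuspidal primary components;
FACT-LIST F-0559): given (i) on primes and `ℚ_{≥0}`-components, the typed clause follows from the compatibility of
`Ψ^Φ_{A_⊚}` with the cuspidal component isomorphisms at ONE non-trivial element per pair.
[cite: MochizukiEtTh2009, Prop 5.3 (iii) p.325 (PDF p.99)] -/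
theorem preservesCspComponentIsos_of_generators (hc : CuspPreserved 𝔓 Ψ ι e)
    (hQ : ∀ 𝔭 : Primes 𝔉.PhiAcirc, Nonempty (𝔭.submonoid ≃* Multiplicative ℚ≥0))
    (hgen : ∀ (p q : Primes 𝔉.PhiAcirc) (hp : 𝔓.IsCuspidal p) (hq : 𝔓.IsCuspidal q), p ≠ q →
      ∃ x₀ : p.submonoid, x₀ ≠ 1 ∧
        psiPhi 𝔉 Ψ ι e (𝔓.cspIso p q hp hq x₀ : 𝔉.PhiAcirc) =
          (𝔓.cspIso _ _ ((hc p).mpr hp) ((hc q).mpr hq)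
            (Primes.submonoidCongr (psiPhi 𝔉 Ψ ι e) p _ rfl x₀) : 𝔉.PhiAcirc)) :
    PreservesCspComponentIsos 𝔓 Ψ ι e hc := by
  intro p q hp hq hpq x
  obtain ⟨x₀, hx₀, h₀⟩ := hgen p q hp hq hpq
  exact apply_componentIso_eq_of_apply_eq (psiPhi 𝔉 Ψ ι e) hQ p q (𝔓.cspIso p q hp hq) _ x₀ hx₀ h₀ x

/-- Conversely the one-element compatibility is (trivially) necessary: Prop. 5.3 (iii) as typed IS the all-elements
form.  [cite: MochizukiEtTh2009, Prop 5.3 (iii) p.325 (PDF p.99)] -/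
theorem generators_of_preservesCspComponentIsos (hc : CuspPreserved 𝔓 Ψ ι e)
    (h : PreservesCspComponentIsos 𝔓 Ψ ι e hc) (p q : Primes 𝔉.PhiAcirc) (hp : 𝔓.IsCuspidal p)
    (hq : 𝔓.IsCuspidal q) (hpq : p ≠ q) (x₀ : p.submonoid) :
    psiPhi 𝔉 Ψ ι e (𝔓.cspIso p q hp hq x₀ : 𝔉.PhiAcirc) =
      (𝔓.cspIso _ _ ((hc p).mpr hp) ((hc q).mpr hq)
        (Primes.submonoidCongr (psiPhi 𝔉 Ψ ι e) p _ rfl x₀) : 𝔉.PhiAcirc) :=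
  h p q hp hq hpq x₀

/-- Components that are copies of `ℚ_{≥0}` are perfect — consistent with Prop. 5.1's "`Φ(−)` perfect" (and, by
`Primes.isPerfect_submonoid_of_isPerfect` of the vacuity certificate, FORCED to be perfect by it).
[cite: MochizukiEtTh2009, Prop 5.1 p.323 (PDF p.97)] -/
theorem isPerfect_submonoid_of_equiv_nnrat (𝔭 : Primes 𝔉.PhiAcirc) (i : 𝔭.submonoid ≃* Multiplicative ℚ≥0) :
    IsPerfect 𝔭.submonoid :=
  isPerfect_of_mulEquiv_nnrat i

end FrobenioidThetaDivisors

end Literature.AnabelianGeometry.EtaleTheta
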